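import Mathlib.LinearAlgebra.Matrix.SchurComplement
import Mathlib.Algebra.Ring.GeomSum
import Literature.Computability.AlgebraicComplexity.DetReprEquivalent
import Literature.Computability.AlgebraicComplexity.PencilFamily
import Literature.Computability.AlgebraicComplexity.LandsbergRessayreNormalForm

/-!
# Crux `RankRigidMinimalRepr` (stmt-ValiantsHypothesis-18034), line `PairTiedTorusBound`, stub `stub_levelDecomp` —
# step 1: the path expansion of an affine matrix in the normal form `Λ_{i₀} + (linear)` with EXPLICIT blocks

Route `ValiantsHypothesis/RigidityForcesSymmetry`, crux `RankRigidMinimalRepr`, registered line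
`Cruxes/RankRigidMinimalRepr/Lines/PairTiedTorusBound.lean`, dictionary stub `stub_levelDecomp` (helper 1 of the
proof).  Convention of the tree's LR17 files: `m` = size of the permanent, `n + 1` = size of the matrix.

**Statement (`neg_dotProduct_pow_mulVec_eq_of_constPart_eq_lamMatrix`).**  Let `f` be a form of degree `d ≥ 2`
over a field `F` and `M` an `(n+1) × (n+1)` matrix of affine polynomials with `det M = κ · f` whose constant part
is ALREADY the Landsberg–Ressayre normal form `Λ_{i₀}` (`1` on the diagonal except `0` at `(i₀, i₀)`).  Write the
linear part of `M` around `i₀` in blocks: `b_j = hc₁ (M i₀ (i₀.succAbove j))`, `c_j = hc₁ (M (i₀.succAbove j) i₀)`,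
`D_{jl} = - hc₁ (M (i₀.succAbove j) (i₀.succAbove l))`.  Then `κ · f = - bᵀ D^{d-2} c`, and `bᵀ Dⁱ c = 0` for
`i + 3 ≤ d`.

This is the tree's `CKV2024.exists_eq_neg_dotProduct_pow_of_isRegularDetRepr`
(`Literature/Computability/AlgebraicComplexity/RegularDetReprABPProofs.lean`, Chatterjee–Kumar–Volk 2024 Thm. 13)
with the gauge FIXED BY THE CALLER instead of chosen inside the proof: the dictionary `stub_levelDecomp` needs the
blocks `b, c, D` to be the blocks of a SPECIFIC gauged matrix (the one written in generalised-eigenspace adapted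
bases of a torus lift), so that their supports are weight-graded.  The proof is the tree's, verbatim up to the
first step (adapted from `RegularDetReprABPProofs.lean`; the private graded-bookkeeping helpers are copied):
reindex `Fin (n+1) ≃ Unit ⊕ Fin n` sending `i₀` to the `Unit` summand and `inr j` to `i₀.succAbove j`; Schur
complement `Matrix.det_fromBlocks₂₂` in the quotient `F[x]/𝔪_{>d}` where `1 - D` is invertible with inverse
`Σ_{i ≤ d} Dⁱ`; comparison of homogeneous components.

HONEST FRAMING: helper toward ONE registered stub of a forward rung inside one route; nothing here bears on the
crux `RankRigidMinimalRepr` itself or on `VP ≠ VNP`.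
-/

set_option autoImplicit false

-- the mandated summit-side namespace repeats a component by design (single-problem summit)
set_option linter.dupNamespace false

noncomputable section

open Matrix MvPolynomial
open Literature.Computability.AlgebraicComplexity

namespace Summit.ValiantsHypothesis.ValiantsHypothesis.Theorems.RigidityForcesSymmetryRankRigidMinimalRepr

namespace PathExpansion

universe u v

variable {F : Type u} [Field F] {σ : Type v}

/-! ### Graded bookkeeping (copied from `RegularDetReprABPProofs.lean`, where they are private) -/

/-- `hc_k (R · φ)` for a form `φ` of degree `n`: it is `φ · hc_{k-n} R` if `n ≤ k` and `0` otherwise. -/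
theorem homogeneousComponent_mul_of_isHomogeneous_right {φ : MvPolynomial σ F} {n : ℕ}
    (hφ : φ.IsHomogeneous n) (R : MvPolynomial σ F) (k : ℕ) :
    homogeneousComponent k (R * φ) = if n ≤ k then φ * homogeneousComponent (k - n) R else 0 := by
  classical
  split_ifs with h
  · obtain ⟨j, rfl⟩ := Nat.exists_eq_add_of_le h
    rw [mul_comm, homogeneousComponent_mul_of_isHomogeneous hφ R j, Nat.add_sub_cancel_left]
  · rw [mul_comm, ← sum_homogeneousComponent R, Finset.mul_sum, map_sum]
    refine Finset.sum_eq_zero fun j _ => ?_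
    rw [homogeneousComponent_of_mem (hφ.mul (homogeneousComponent_isHomogeneous j R)), if_neg]
    omega

/-- The entries of `D ^ n` are forms of degree `n` when the entries of `D` are linear forms. -/
theorem isHomogeneous_pow_apply {ι : Type*} [Fintype ι] [DecidableEq ι]
    {D : Matrix ι ι (MvPolynomial σ F)} (hD : ∀ i j, (D i j).IsHomogeneous 1) (n : ℕ) (i j : ι) :
    ((D ^ n) i j).IsHomogeneous n := by
  induction n generalizing i j with
  | zero =>
    rw [pow_zero, Matrix.one_apply]
    split_ifs
    · exact isHomogeneous_one σ F
    · exact isHomogeneous_zero σ F 0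
  | succ n ih =>
    rw [pow_succ, Matrix.mul_apply]
    exact IsHomogeneous.sum _ _ _ fun l _ => (ih i l).mul (hD l j)

/-- `bᵀ Dⁿ c` is a form of degree `n + 2` for linear `b, c, D`. -/
theorem isHomogeneous_dotProduct_pow_mulVec {ι : Type*} [Fintype ι] [DecidableEq ι]
    {b c : ι → MvPolynomial σ F} {D : Matrix ι ι (MvPolynomial σ F)}
    (hb : ∀ j, (b j).IsHomogeneous 1) (hD : ∀ i j, (D i j).IsHomogeneous 1)
    (hc : ∀ j, (c j).IsHomogeneous 1) (n : ℕ) :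
    (b ⬝ᵥ (D ^ n) *ᵥ c).IsHomogeneous (n + 2) := by
  simp only [dotProduct, Matrix.mulVec]
  refine IsHomogeneous.sum _ _ _ fun j _ => ?_
  have h2 : (∑ l, (D ^ n) j l * c l).IsHomogeneous (n + 1) :=
    IsHomogeneous.sum _ _ _ fun l _ => (isHomogeneous_pow_apply hD n j l).mul (hc l)
  have h3 := (hb j).mul h2
  rwa [show 1 + (n + 1) = n + 2 by ring] at h3

/-- `(B · X · C)_{⋆⋆} = bᵀ X c` for a one-row `B = (bᵀ)` and a one-column `C = (c)`. -/
theorem row_mul_mul_col_apply {ι : Type*} [Fintype ι] (b c : ι → MvPolynomial σ F)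
    (X : Matrix ι ι (MvPolynomial σ F)) :
    (Matrix.of (fun (_ : Unit) j => b j) * X * Matrix.of (fun j (_ : Unit) => c j)) () () =
      b ⬝ᵥ X *ᵥ c := by
  rw [Matrix.mul_assoc]
  simp only [Matrix.mul_apply, Matrix.of_apply, dotProduct, Matrix.mulVec]

/-- Linear forms have no constant term. -/
theorem constantCoeff_eq_zero_of_isHomogeneous_one {p : MvPolynomial σ F} (hp : p.IsHomogeneous 1) :
    constantCoeff p = 0 := by
  rw [constantCoeff_eq]
  exact hp.coeff_eq_zero (by simp)

/-- `det (1 - D)` has constant term `1` when `D` is a matrix of linear forms. -/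
theorem homogeneousComponent_zero_det_one_sub {ι : Type*} [Fintype ι] [DecidableEq ι]
    {D : Matrix ι ι (MvPolynomial σ F)} (hD : ∀ i j, (D i j).IsHomogeneous 1) :
    homogeneousComponent 0 ((1 - D).det - 1) = 0 := by
  have h : constPart (1 - D) = 1 := by
    ext i j
    rw [constPart_apply, Matrix.sub_apply, map_sub, constantCoeff_eq_zero_of_isHomogeneous_one (hD i j),
      sub_zero, Matrix.one_apply, Matrix.one_apply]
    split_ifs <;> simp
  have hc : constantCoeff ((1 - D).det - 1) = 0 := by
    rw [map_sub, ← det_constPart, h, Matrix.det_one, map_one, sub_self]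
  have hc' : coeff 0 ((1 - D).det - 1) = 0 := hc
  rw [homogeneousComponent_zero, hc', C_0]

/-! ### The path expansion with explicit blocks -/

/-- **Path expansion in a fixed gauge** (Chatterjee–Kumar–Volk 2024 Thm. 13, proof, with the normal form given):
if `f` is a form of degree `d ≥ 2`, `M` is affine with `det M = κ f` and constant part `Λ_{i₀}`, then with the
explicit blocks `b_j = hc₁ (M i₀ (i₀.succAbove j))`, `c_j = hc₁ (M (i₀.succAbove j) i₀)`,
`D_{jl} = -hc₁ (M (i₀.succAbove j) (i₀.succAbove l))` of its linear part one has
`-bᵀ D^{d-2} c = κ f` and `bᵀ Dⁱ c = 0` for `i + 3 ≤ d`.  (Adapted from the tree's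
`CKV2024.exists_eq_neg_dotProduct_pow_of_isRegularDetRepr`, whose proof this is after its first step.) -/
theorem neg_dotProduct_pow_mulVec_eq_of_constPart_eq_lamMatrix [Fintype σ] {n : ℕ}
    (f : MvPolynomial σ F) (d : ℕ) (hf : f.IsHomogeneous d) (hd : 2 ≤ d)
    (M₀ : Matrix (Fin (n + 1)) (Fin (n + 1)) (MvPolynomial σ F))
    (hMdeg₀ : ∀ x y, (M₀ x y).totalDegree ≤ 1) (κ : F) (hMdet₀ : M₀.det = C κ * f)
    (i₀ : Fin (n + 1)) (hM₀ : constPart M₀ = lamMatrix F i₀) :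
    -((fun j => homogeneousComponent 1 (M₀ i₀ (i₀.succAbove j))) ⬝ᵥ
        ((Matrix.of fun j l => -homogeneousComponent 1 (M₀ (i₀.succAbove j) (i₀.succAbove l))) ^ (d - 2)) *ᵥ
          fun j => homogeneousComponent 1 (M₀ (i₀.succAbove j) i₀)) = C κ * f ∧
      ∀ i : ℕ, i + 3 ≤ d →
        (fun j => homogeneousComponent 1 (M₀ i₀ (i₀.succAbove j))) ⬝ᵥ
          ((Matrix.of fun j l => -homogeneousComponent 1 (M₀ (i₀.succAbove j) (i₀.succAbove l))) ^ i) *ᵥ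
            (fun j => homogeneousComponent 1 (M₀ (i₀.succAbove j) i₀)) = 0 := by
  classical
  -- reindex so that `i₀` becomes the `Unit` summand: `M = [[α, bᵀ], [c, 1 - D]]`
  set e : Fin (n + 1) ≃ Unit ⊕ Fin n :=
    ((finSuccEquiv' i₀).trans (Equiv.optionEquivSumPUnit.{0} (Fin n))).trans (Equiv.sumComm _ _)
    with he
  have he₀ : e i₀ = Sum.inl () := by rw [he]; simp [finSuccEquiv'_at]
  have hsinl : e.symm (Sum.inl ()) = i₀ := by rw [Equiv.symm_apply_eq]; exact he₀.symm
  have hsinr' : ∀ j, e.symm (Sum.inr j) = i₀.succAbove j := fun j => by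
    rw [Equiv.symm_apply_eq, he]
    simp [finSuccEquiv'_succAbove]
  have hsinr : ∀ j, e.symm (Sum.inr j) ≠ i₀ := fun j => by
    rw [hsinr' j]; exact Fin.succAbove_ne i₀ j
  set M : Matrix (Unit ⊕ Fin n) (Unit ⊕ Fin n) (MvPolynomial σ F) := Matrix.reindex e e M₀ with hM
  have hMdet : M.det = C κ * f := by rw [hM, Matrix.det_reindex_self, hMdet₀]
  have hMdeg : ∀ x y, (M x y).totalDegree ≤ 1 := fun x y => hMdeg₀ _ _
  have hMcc : ∀ x y, constantCoeff (M x y) = lamMatrix F i₀ (e.symm x) (e.symm y) := fun x y => by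
    have h := congrFun (congrFun hM₀ (e.symm x)) (e.symm y)
    rw [constPart_apply] at h
    exact h
  -- the linear part `N` of `M`
  set N : Matrix (Unit ⊕ Fin n) (Unit ⊕ Fin n) (MvPolynomial σ F) :=
    Matrix.of fun x y => homogeneousComponent 1 (M x y) with hN
  have hNhom : ∀ x y, (N x y).IsHomogeneous 1 := fun x y => by
    rw [hN, Matrix.of_apply]; exact homogeneousComponent_isHomogeneous 1 _
  have hMN : ∀ x y, M x y = C (lamMatrix F i₀ (e.symm x) (e.symm y)) + N x y := fun x y => by
    rw [hN, Matrix.of_apply, ← hMcc]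
    conv_lhs => rw [eq_homogeneousComponent_zero_add_one (hMdeg x y)]
    rw [homogeneousComponent_zero]
    rfl
  -- the blocks
  set α : MvPolynomial σ F := N (Sum.inl ()) (Sum.inl ()) with hα
  set b : Fin n → MvPolynomial σ F := fun j => N (Sum.inl ()) (Sum.inr j) with hb
  set c : Fin n → MvPolynomial σ F := fun j => N (Sum.inr j) (Sum.inl ()) with hc
  set D : Matrix (Fin n) (Fin n) (MvPolynomial σ F) :=
    Matrix.of fun j l => -N (Sum.inr j) (Sum.inr l) with hD
  -- they ARE the explicit blocks of `M₀`
  have hb₀ : (fun j => homogeneousComponent 1 (M₀ i₀ (i₀.succAbove j))) = b := by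
    funext j
    rw [hb]
    show _ = N (Sum.inl ()) (Sum.inr j)
    rw [hN, Matrix.of_apply, hM, Matrix.reindex_apply, Matrix.submatrix_apply, hsinl, hsinr']
  have hc₀ : (fun j => homogeneousComponent 1 (M₀ (i₀.succAbove j) i₀)) = c := by
    funext j
    rw [hc]
    show _ = N (Sum.inr j) (Sum.inl ())
    rw [hN, Matrix.of_apply, hM, Matrix.reindex_apply, Matrix.submatrix_apply, hsinl, hsinr']
  have hD₀ : (Matrix.of fun j l => -homogeneousComponent 1 (M₀ (i₀.succAbove j) (i₀.succAbove l))) = D := by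
    ext j l
    rw [Matrix.of_apply, hD, Matrix.of_apply, hN, Matrix.of_apply, hM, Matrix.reindex_apply,
      Matrix.submatrix_apply, hsinr', hsinr']
  rw [hb₀, hc₀, hD₀]
  have hDhom : ∀ j l, (D j l).IsHomogeneous 1 := fun j l => by
    rw [hD, Matrix.of_apply]; exact (hNhom _ _).neg
  have hbhom : ∀ j, (b j).IsHomogeneous 1 := fun j => hNhom _ _
  have hchom : ∀ j, (c j).IsHomogeneous 1 := fun j => hNhom _ _
  have hαhom : α.IsHomogeneous 1 := hNhom _ _
  set Bb : Matrix Unit (Fin n) (MvPolynomial σ F) := Matrix.of fun _ j => b j with hBb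
  set Cc : Matrix (Fin n) Unit (MvPolynomial σ F) := Matrix.of fun j _ => c j with hCc
  set Aα : Matrix Unit Unit (MvPolynomial σ F) := Matrix.of fun _ _ => α with hAα
  have hMblocks : M = Matrix.fromBlocks Aα Bb Cc (1 - D) := by
    ext x y
    rw [hMN x y]
    rcases x with ⟨⟩ | j <;> rcases y with ⟨⟩ | l
    · rw [Matrix.fromBlocks_apply₁₁, hAα, Matrix.of_apply, hsinl, lamMatrix_apply, if_pos rfl,
        if_pos rfl, C_0, zero_add]
    · rw [Matrix.fromBlocks_apply₁₂, hBb, Matrix.of_apply, hsinl, lamMatrix_apply,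
        if_neg (hsinr l).symm, C_0, zero_add]
    · rw [Matrix.fromBlocks_apply₂₁, hCc, Matrix.of_apply, hsinl, lamMatrix_apply,
        if_neg (hsinr j), C_0, zero_add]
    · rw [Matrix.fromBlocks_apply₂₂, Matrix.sub_apply, hD, Matrix.of_apply, sub_neg_eq_add,
        Matrix.one_apply, lamMatrix_apply]
      by_cases hjl : j = l
      · subst hjl
        rw [if_pos rfl, if_neg (hsinr j), if_pos rfl, C_1]
      · have hne : e.symm (Sum.inr j) ≠ e.symm (Sum.inr l) := fun h =>
          hjl (Sum.inr_injective (e.symm.injective h))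
        rw [if_neg hne, if_neg hjl, C_0]
  -- Schur complement in `F[x]/𝔪_{>d}`, where `1 - D` is invertible with inverse `S = Σ_{i ≤ d} Dⁱ`
  set I : Ideal (MvPolynomial σ F) :=
    { carrier := {p | ∀ k ≤ d, homogeneousComponent k p = 0}
      zero_mem' := fun k _ => map_zero _
      add_mem' := fun {p q} hp hq k hk => by
        show homogeneousComponent k (p + q) = 0
        rw [map_add, hp k hk, hq k hk, add_zero]
      smul_mem' := fun r {p} hp k hk => by
        show homogeneousComponent k (r • p) = 0
        rw [smul_eq_mul, mul_comm, ← sum_homogeneousComponent r, Finset.mul_sum, map_sum]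
        refine Finset.sum_eq_zero fun i _ => ?_
        rw [homogeneousComponent_mul_of_isHomogeneous_right (homogeneousComponent_isHomogeneous i r) p k]
        split_ifs with hik
        · rw [hp (k - i) (by omega), mul_zero]
        · rfl } with hI
  have hmemI : ∀ {p : MvPolynomial σ F}, p ∈ I ↔ ∀ k ≤ d, homogeneousComponent k p = 0 :=
    fun {p} => Iff.rfl
  have hmemI_of : ∀ {n : ℕ} {p : MvPolynomial σ F}, p.IsHomogeneous n → d < n → p ∈ I :=
    fun {n} {p} hp hn => hmemI.2 fun k hk => by
      rw [homogeneousComponent_of_mem hp, if_neg]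
      omega
  set S : Matrix (Fin n) (Fin n) (MvPolynomial σ F) := ∑ i ∈ Finset.range (d + 1), D ^ i with hS
  have hπ0 : ∀ a : MvPolynomial σ F, Ideal.Quotient.mk I a = 0 ↔ a ∈ I := fun a =>
    Ideal.Quotient.eq_zero_iff_mem
  have hDq : ((Ideal.Quotient.mk I).mapMatrix D) ^ (d + 1) = 0 := by
    rw [← map_pow]
    ext j l
    rw [RingHom.mapMatrix_apply, Matrix.map_apply, Matrix.zero_apply, hπ0]
    exact hmemI_of (isHomogeneous_pow_apply hDhom (d + 1) j l) (by omega)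
  have hS1 : (1 - D) * S = 1 - D ^ (d + 1) := mul_neg_geom_sum D (d + 1)
  have hS2 : S * (1 - D) = 1 - D ^ (d + 1) := geom_sum_mul_neg D (d + 1)
  have hS1q : (1 - D).map (Ideal.Quotient.mk I) * S.map (Ideal.Quotient.mk I) = 1 := by
    rw [← Matrix.map_mul, hS1, ← RingHom.mapMatrix_apply, map_sub, map_one, map_pow, hDq, sub_zero]
  have hS2q : S.map (Ideal.Quotient.mk I) * (1 - D).map (Ideal.Quotient.mk I) = 1 := by
    rw [← Matrix.map_mul, hS2, ← RingHom.mapMatrix_apply, map_sub, map_one, map_pow, hDq, sub_zero]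
  haveI hinv : Invertible ((1 - D).map (Ideal.Quotient.mk I)) := ⟨S.map (Ideal.Quotient.mk I), hS2q, hS1q⟩
  have hinvOf : ⅟((1 - D).map (Ideal.Quotient.mk I)) = S.map (Ideal.Quotient.mk I) :=
    invOf_eq_right_inv hS1q
  -- the generators `T i = bᵀ Dⁱ c` and the truncated Schur complement `g = α - Σ_{i ≤ d} T i`
  set T : ℕ → MvPolynomial σ F := fun i => b ⬝ᵥ (D ^ i) *ᵥ c with hT
  have hThom : ∀ i, (T i).IsHomogeneous (i + 2) := fun i =>
    isHomogeneous_dotProduct_pow_mulVec hbhom hDhom hchom i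
  have hBSC : (Bb * S * Cc) () () = ∑ i ∈ Finset.range (d + 1), T i := by
    rw [hS, Matrix.mul_sum, Matrix.sum_mul, Matrix.sum_apply]
    exact Finset.sum_congr rfl fun i _ => row_mul_mul_col_apply b c (D ^ i)
  set g : MvPolynomial σ F := α - ∑ i ∈ Finset.range (d + 1), T i with hg
  have hdetq : Ideal.Quotient.mk I M.det = Ideal.Quotient.mk I ((1 - D).det * g) := by
    have hdu : ∀ X : Matrix Unit Unit (MvPolynomial σ F ⧸ I), X.det = X () () := fun X =>
      Matrix.det_unique X
    rw [RingHom.map_det, RingHom.mapMatrix_apply, hMblocks, Matrix.fromBlocks_map,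
      Matrix.det_fromBlocks₂₂, hdu,
      hinvOf,
      ← Matrix.map_mul, ← Matrix.map_mul, Matrix.sub_apply, Matrix.map_apply, Matrix.map_apply,
      hBSC, hAα, Matrix.of_apply, ← map_sub, ← hg, ← RingHom.mapMatrix_apply, ← RingHom.map_det,
      ← map_mul]
  have hmem : C κ * f - (1 - D).det * g ∈ I := by
    rw [← Ideal.Quotient.eq, ← hMdet]
    exact hdetq
  -- comparison of homogeneous components: `det (1 - D) = 1 + R`, `R(0) = 0`
  set R : MvPolynomial σ F := (1 - D).det - 1 with hR
  have hR0 : homogeneousComponent 0 R = 0 := homogeneousComponent_zero_det_one_sub hDhom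
  have hdetR : (1 - D).det = 1 + R := by rw [hR]; ring
  have key : ∀ k ≤ d,
      ((if k = 1 then α else 0) - ∑ i ∈ Finset.range (d + 1), (if k = i + 2 then T i else 0)) +
        ((if 1 ≤ k then α * homogeneousComponent (k - 1) R else 0) -
          ∑ i ∈ Finset.range (d + 1),
            (if i + 2 ≤ k then T i * homogeneousComponent (k - (i + 2)) R else 0)) =
        C κ * (if k = d then f else 0) := by
    intro k hk
    have h := (hmemI.1 hmem) k hk
    rw [map_sub, sub_eq_zero, homogeneousComponent_C_mul, homogeneousComponent_of_mem hf, hdetR,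
      add_mul, one_mul, map_add] at h
    rw [h]
    congr 1
    · rw [hg, (homogeneousComponent k).map_sub α, map_sum, homogeneousComponent_of_mem hαhom]
      congr 1
      exact (Finset.sum_congr rfl fun i _ => homogeneousComponent_of_mem (hThom i)).symm
    · rw [hg, mul_sub, Finset.mul_sum, (homogeneousComponent k).map_sub (R * α), map_sum,
        homogeneousComponent_mul_of_isHomogeneous_right hαhom]
      congr 1
      exact (Finset.sum_congr rfl fun i _ =>
        homogeneousComponent_mul_of_isHomogeneous_right (hThom i) R k).symm
  -- degree `1`: `α = 0`
  have hα0 : α = 0 := by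
    have h := key 1 (by omega)
    have hz1 : (∑ i ∈ Finset.range (d + 1), (if 1 = i + 2 then T i else 0)) = 0 :=
      Finset.sum_eq_zero fun i _ => if_neg (by omega)
    have hz2 : (∑ i ∈ Finset.range (d + 1),
        (if i + 2 ≤ 1 then T i * homogeneousComponent (1 - (i + 2)) R else 0)) = 0 :=
      Finset.sum_eq_zero fun i _ => if_neg (by omega)
    rw [if_pos rfl, if_pos le_rfl, Nat.sub_self, hR0, mul_zero, hz1, hz2, sub_zero, sub_zero,
      add_zero, if_neg (show ¬ (1 = d) by omega), mul_zero] at h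
    exact h
  -- degree `i + 2`: `-T i = κ f` if `i + 2 = d`, and `0` below, given the lower `T i'` vanish
  have step : ∀ i, i + 2 ≤ d → (∀ i', i' < i → T i' = 0) →
      -T i = C κ * (if i + 2 = d then f else 0) := by
    intro i hi hprev
    have h := key (i + 2) hi
    have hsum1 : (∑ i' ∈ Finset.range (d + 1), (if i + 2 = i' + 2 then T i' else 0)) = T i := by
      rw [Finset.sum_eq_single i, if_pos rfl]
      · intro i' _ hne; exact if_neg (by omega)
      · intro hi'; exact absurd (Finset.mem_range.2 (by omega)) hi'
    have hsum2 : (∑ i' ∈ Finset.range (d + 1),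
        (if i' + 2 ≤ i + 2 then T i' * homogeneousComponent (i + 2 - (i' + 2)) R else 0)) = 0 := by
      refine Finset.sum_eq_zero fun i' _ => ?_
      split_ifs with hle
      · rcases Nat.lt_or_ge i' i with hlt | hge
        · rw [hprev i' hlt, zero_mul]
        · obtain rfl : i' = i := by omega
          rw [Nat.sub_self, hR0, mul_zero]
      · rfl
    rw [if_neg (show ¬ (i + 2 = 1) by omega), zero_sub, hsum1, if_pos (show 1 ≤ i + 2 by omega),
      hα0, zero_mul, zero_sub, hsum2, neg_zero, add_zero] at h
    exact h
  have hvan : ∀ i, i + 3 ≤ d → T i = 0 := by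
    intro i
    induction i using Nat.strong_induction_on with
    | _ i ih =>
      intro hi
      have h := step i (by omega) fun i' hi' => ih i' hi' (by omega)
      rwa [if_neg (show ¬ (i + 2 = d) by omega), mul_zero, neg_eq_zero] at h
  have hfin : -T (d - 2) = C κ * f := by
    have h := step (d - 2) (by omega) fun i' hi' => hvan i' (by omega)
    rwa [if_pos (show d - 2 + 2 = d by omega)] at h
  exact ⟨hfin, hvan⟩

end PathExpansion

end Summit.ValiantsHypothesis.ValiantsHypothesis.Theorems.RigidityForcesSymmetryRankRigidMinimalRepr

end
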